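import Literature.Geometry.Kaehler.ComplexTorusAnalyticTranslatesConservationOfNumber
import Literature.Geometry.Kaehler.ComplexTorusAbelianVarietyIteratedTranslatesClass
import HarnessLib

/-!
# Multiplicity one is an open condition: lower semicontinuity of the degree of a proper iterated
# intersection `Z(τ) = Y ∩ ⋂_j (D_j − τ_j)` and openness of the locus where
# `sign(e)^k · [Y] ∧ [D₀] ∧ ⋯ ∧ [D_{k−1}] = [Z(τ)]`

Layer `Literature/Geometry/Kaehler`; lane `lit-hodgefound`, seat p07, programme «INTERSECTION NUMBERS ARE
POINT COUNTS», file 13. Let `X = E/Λ` be a compact complex torus of dimension `g`, `Y ⊆ X` closed analytic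
of pure dimension `d = r + k`, `D₀, …, D_{k−1} ⊆ X` closed analytic hypersurfaces, `Z(τ) = Y ∩ ⋂_j (D_j − τ_j)`
for `τ ∈ X^k`, and `c = sign(e)^k · [Y]_e ∧ [D₀]_e ∧ ⋯ ∧ [D_{k−1}]_e` the intersection class. For every PROPER `τ`
(`Z(τ)` empty or of pure dimension `r`) file 8 gives `c = [Z(τ)]_e + cl(T_τ)` with `T_τ ≥ 0` an analytic
`r`-cycle on `Z(τ)`; `τ` has MULTIPLICITY ONE when `T_τ = 0`, i.e. `c = [Z(τ)]_e`. We prove: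

1. the flat Kähler degree `deg Z(τ) = Re ⟨ω^r/r!, [Z(τ)]⟩ = vol_{2r} Z(τ)` is LOWER SEMICONTINUOUS on the
   proper locus: `deg Z(τ⁰) ≤ liminf_{τ → τ⁰, Z(τ) proper} deg Z(τ)` — along any `τ_m → τ⁰` a subsequence
   of the reduced cycles `[Z(τ_m)]` (degrees `≤ deg c`) converges, with eventually constant class, to an
   effective cycle whose support is the limit set of `Z(τ_m)`, which is `Z(τ⁰)` (persistence by Remmert's
   open mapping theorem, and closedness), hence which dominates `[Z(τ⁰)]`
   ([Chirka1989, §16.1 Prop. 1; Fujiki1978, Prop. 4.1] for the compactness of cycles of bounded volume);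
2. **MULTIPLICITY ONE IS OPEN** on every compact complex torus: if `c = [Z(τ⁰)]` then `c = [Z(τ)]` for all
   `τ` near `τ⁰` — the excess `T_τ` has degree `deg c − deg Z(τ) < v` by (1), while a non-zero effective
   `r`-cycle has degree `≥ v > 0`, the uniform lower volume bound of `r`-dimensional analytic subsets of `X`
   (`exists_pos_le_volume`, Lelong);
3. under the positivity hypothesis (P) of file 5 — in particular on every ABELIAN VARIETY — the
   multiplicity-one locus is OPEN, DENSE and of FULL Haar measure (file 5/6 give full measure).

This is the analytic counterpart, for translates on a torus, of the openness of transversality in Kleiman's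
theorem and of "the set `T°` of `t` with `X_t` meeting `V_t` properly [with the generic multiplicities] is
open" in the principle of conservation of number. [Fulton1998, §10.2 Cor. 10.2.1/10.2.2 and Example 10.2.1;
§11.1 Cor. 11.1; Appendix B.9.2] [Kleiman1974Transversality, Thm. 2] [Chirka1989, §12.1 Prop. (p. 139),
§15.5, §16.1 Prop. 1].

Contents (theorems only; no definitions, no named facts):

* §1 **`eventually_lt_re_poincarePairing_kaehlerPow_setCycleClass_of_proper`** — lower semicontinuity of
  `deg Z(τ)` on the proper locus (every `r`; `r = 0` by the lower semicontinuity of `#Z(τ)`, file 11);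
* §2 **`isOpen_setOf_proper_and_smul_wedge_wedgeFamily_eq_setCycleClass`** — the multiplicity-one locus
  `{τ | Z(τ) proper, c = [Z(τ)]}` is open;
* §3 `isOpen_dense_ae_proper_and_smul_wedge_wedgeFamily_eq_setCycleClass` (under (P)) and
  **`IsAbelianVariety.isOpen_dense_ae_proper_and_smul_wedge_wedgeFamily_eq_setCycleClass`** — open, dense and
  of full measure.

## References

* [Fulton1998] W. Fulton, *Intersection Theory*, 2nd ed., Springer 1998, §10.2 (Cor. 10.2.1, 10.2.2,
  Example 10.2.1), §11.1 Cor. 11.1, Example 11.4.5, Appendix B.9.2.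
* [Kleiman1974Transversality] S. L. Kleiman, *The transversality of a general translate*, Compositio Math.
  28 (1974) 287–297, Thm. 2.
* [Chirka1989] E. M. Chirka, *Complex Analytic Sets*, Kluwer 1989, §12.1 Prop. (p. 139), §15.5 (p. 202),
  §16.1 Prop. 1 (p. 206).
* [Fujiki1978] A. Fujiki, *Closedness of the Douady spaces of compact Kähler spaces*, Publ. RIMS 14 (1978),
  §4 Prop. 4.1.
* [Lange2023AbelianVarietiesComplex] H. Lange, *Abelian Varieties over the Complex Numbers*, Springer 2023,
  §4.6.2 Lemma 4.6.4 and p. 235; §6.2.1.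
-/

noncomputable section

open scoped Manifold Topology Pointwise
open MeasureTheory Set Function Filter Module
open Literature.LinearAlgebra.Alternating

namespace Literature.Geometry.Kaehler
namespace ComplexTorus

universe u

variable {ι : Type*} [Fintype ι] [DecidableEq ι] {E : Type u} [NormedAddCommGroup E] [InnerProductSpace ℂ E]
  [FiniteDimensional ℂ E] [MeasurableSpace E] [BorelSpace E] (Φ : (ι → ℝ) ≃L[ℝ] E) {n : ℕ} (e : Fin n ≃ ι)

/-! ### §0 Degrees of proper members -/

/-- `deg Z ≥ 0` for `Z` empty or of pure dimension `r` (`deg ∅ = 0`, `deg Z = vol_{2r} Z`).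
[cite: Chirka1989, §13.3 Cor. and §14.1] -/
private theorem re_poincarePairing_kaehlerPow_setCycleClass_nonneg_of_proper {r k' : ℕ} (h : 2 * r + k' = n)
    {Z : Set (ComplexTorus Φ)} (hZ : Z = ∅ ∨ HasPureDim 𝓘(ℂ, E) Z r) :
    0 ≤ (poincarePairing Φ e h (Complex.ofRealCLM.compContinuousAlternatingMap (kaehlerPow r))
      (setCycleClass Φ e h Z)).re := by
  rcases hZ with h0 | hP
  · have hne : ¬ HasPureDim 𝓘(ℂ, E) Z r := fun h' ↦ by
      have := h'.nonempty
      rw [h0] at this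
      exact Set.not_nonempty_empty this
    rw [setCycleClass, dif_neg hne, map_zero, Complex.zero_re]
  · rw [re_poincarePairing_kaehlerPow_setCycleClass Φ e h hP]
    exact measureReal_nonneg

/-- `deg ∅ = 0`. [folklore] -/
private theorem re_poincarePairing_kaehlerPow_setCycleClass_of_eq_empty {r k' : ℕ} (h : 2 * r + k' = n)
    {Z : Set (ComplexTorus Φ)} (h0 : Z = ∅) :
    (poincarePairing Φ e h (Complex.ofRealCLM.compContinuousAlternatingMap (kaehlerPow r))
      (setCycleClass Φ e h Z)).re = 0 := by
  have hne : ¬ HasPureDim 𝓘(ℂ, E) Z r := fun h' ↦ by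
    have := h'.nonempty
    rw [h0] at this
    exact Set.not_nonempty_empty this
  rw [setCycleClass, dif_neg hne, map_zero, Complex.zero_re]

/-- In dimension `0`, `deg Z = #Z · deg[pt]`. [cite: VoisinHodgeI2002, §12.1.3] -/
private theorem re_poincarePairing_kaehlerPow_setCycleClass_of_hasPureDim_zero {k' : ℕ} (h : 2 * 0 + k' = n)
    {Z : Set (ComplexTorus Φ)} (hZ : HasPureDim 𝓘(ℂ, E) Z 0) :
    (poincarePairing Φ e h (Complex.ofRealCLM.compContinuousAlternatingMap (kaehlerPow 0))
        (setCycleClass Φ e h Z)).re =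
      Z.ncard * (poincarePairing Φ e h (Complex.ofRealCLM.compContinuousAlternatingMap (kaehlerPow 0))
        (analyticCycleClass Φ e h (hasPureDim_singleton (0 : ComplexTorus Φ)))).re := by
  rw [setCycleClass_of_hasPureDim Φ e h hZ, analyticCycleClass_eq_ncard_smul_of_hasPureDim_zero Φ e h hZ, map_smul,
    smul_eq_mul, show ((Z.ncard : ℕ) : ℂ) = ((Z.ncard : ℝ) : ℂ) by norm_cast, Complex.re_ofReal_mul]

/-- `deg[pt] ≥ 0`. [folklore] -/
private theorem re_poincarePairing_kaehlerPow_analyticCycleClass_singleton_nonneg {k' : ℕ} (h : 2 * 0 + k' = n) :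
    0 ≤ (poincarePairing Φ e h (Complex.ofRealCLM.compContinuousAlternatingMap (kaehlerPow 0))
      (analyticCycleClass Φ e h (hasPureDim_singleton (0 : ComplexTorus Φ)))).re := by
  rw [← setCycleClass_of_hasPureDim Φ e h (hasPureDim_singleton (0 : ComplexTorus Φ)),
    re_poincarePairing_kaehlerPow_setCycleClass Φ e h (hasPureDim_singleton (0 : ComplexTorus Φ))]
  exact measureReal_nonneg

/-- **A non-zero effective `r`-cycle has degree `≥ v`**, `v > 0` a uniform lower bound for the volumes of the
`r`-dimensional analytic subsets of `X`. [cite: Chirka1989, §15.3 Thm. and §16.1] [cite: Fujiki1978, §4 Prop. 4.1] -/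
private theorem le_re_poincarePairing_kaehlerPow_chainCycleClass_of_ne_zero {r k' : ℕ} (h : 2 * r + k' = n)
    {v : ℝ} (hv : ∀ (Z : Set (ComplexTorus Φ)) (hZ : HasPureDim 𝓘(ℂ, E) Z r),
      v ≤ (μHE[2 * r] : Measure E).real (periodBox Φ 0 ∩ (analyticChain Φ hZ).carrier))
    {T : HolomorphicChain 𝓘(ℂ, E) (ComplexTorus Φ) r} (hT0 : ∀ W, 0 ≤ T.mult W) (hT : T ≠ 0) :
    v ≤ (poincarePairing Φ e h (Complex.ofRealCLM.compContinuousAlternatingMap (kaehlerPow r))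
      (chainCycleClass Φ e h T)).re := by
  classical
  have hsum := sum_toNat_mult_mul_le_degree Φ e h hT0 hv
  have hne : T.finite_components_of_compactSpace.toFinset.Nonempty := by
    rw [Finset.nonempty_iff_ne_empty]
    exact fun h0 ↦ hT ((HolomorphicChain.eq_zero_iff_toFinset_eq_empty T).2 h0)
  obtain ⟨W, hW⟩ := hne
  have hW0 : T.mult W ≠ 0 := T.finite_components_of_compactSpace.mem_toFinset.1 hW
  have h1 : 1 ≤ (T.mult W).toNat := by
    have : 0 < T.mult W := lt_of_le_of_ne (hT0 W) (Ne.symm hW0)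
    omega
  have hle : 1 ≤ ∑ Z ∈ T.finite_components_of_compactSpace.toFinset, (T.mult Z).toNat :=
    h1.trans (Finset.single_le_sum (f := fun Z ↦ (T.mult Z).toNat) (fun Z _ ↦ Nat.zero_le _) hW)
  have hv1 : 0 ≤ v → v ≤ (∑ Z ∈ T.finite_components_of_compactSpace.toFinset, (T.mult Z).toNat : ℕ) * v :=
    fun hv0 ↦ le_mul_of_one_le_left hv0 (by exact_mod_cast hle)
  rcases le_or_gt 0 v with hv0 | hv0
  · exact (hv1 hv0).trans hsum
  · exact hv0.le.trans (re_poincarePairing_kaehlerPow_chainCycleClass_pos Φ e h T hT0 hT).le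

/-! ### §1 Lower semicontinuity of the degree of a proper iterated intersection -/

/-- **LOWER SEMICONTINUITY OF `deg Z(τ)` ON THE PROPER LOCUS.** Let `Y ⊆ X` be closed analytic of pure
dimension `d = r + k`, `D₀, …, D_{k−1}` closed analytic hypersurfaces, and `τ⁰ ∈ X^k` with
`Z(τ⁰) = Y ∩ ⋂_j (D_j − τ⁰_j)` proper (empty or of pure dimension `r`). If `a < deg Z(τ⁰) = Re ⟨ω^r/r!, [Z(τ⁰)]⟩`
then `a < deg Z(τ)` for every `τ` near `τ⁰` with `Z(τ)` proper. For `r ≥ 1`: otherwise some `τ_m → τ⁰` has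
`Z(τ_m)` proper (non-empty by persistence) with `deg Z(τ_m) ≤ a`; the reduced cycles `[Z(τ_m)]` are
effective of bounded degree, so a subsequence converges — with eventually constant class and degree — to
an effective cycle `S` whose support is the limit set of `Z(τ_m)` (`exists_subseq_effectiveCycle_of_degree_le`),
which is `Z(τ⁰)` (`forall_mem_closure_iUnion_iff_of_hasPureDim`); then `S = [Z(τ⁰)] + T`, `T ≥ 0`, and
`deg Z(τ_m) = deg S ≥ deg Z(τ⁰) > a`, a contradiction. For `r = 0`, `deg Z = #Z · deg[pt]` and `#Z(τ)` is
lower semicontinuous (file 11). [cite: Chirka1989, §16.1 Prop. 1 (p. 206), §15.5 and §12.1 Prop. (p. 139)]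
[cite: Fujiki1978, §4 Prop. 4.1] [cite: Fulton1998, §10.2 Example 10.2.1 and §11.1 Cor. 11.1] -/
theorem eventually_lt_re_poincarePairing_kaehlerPow_setCycleClass_of_proper {q : ℕ} (hq : 2 * q + 2 * 1 = n)
    (k : ℕ) {d p p' r : ℕ} (hk : 2 * d + 2 * p = n) (hp' : p + k = p') (hr : r + k = d)
    {Y : Set (ComplexTorus Φ)} (hY : HasPureDim 𝓘(ℂ, E) Y d)
    {D : Fin k → Set (ComplexTorus Φ)} (hD : ∀ j, HasPureDim 𝓘(ℂ, E) (D j) q) (τ₀ : Fin k → ComplexTorus Φ)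
    (hZ : Y ∩ ⋂ j, (fun x ↦ x + τ₀ j) ⁻¹' D j = ∅ ∨
      HasPureDim 𝓘(ℂ, E) (Y ∩ ⋂ j, (fun x ↦ x + τ₀ j) ⁻¹' D j) r)
    {a : ℝ} (ha : a < (poincarePairing Φ e (by omega : 2 * r + 2 * p' = n)
      (Complex.ofRealCLM.compContinuousAlternatingMap (kaehlerPow r))
      (setCycleClass Φ e (by omega : 2 * r + 2 * p' = n) (Y ∩ ⋂ j, (fun x ↦ x + τ₀ j) ⁻¹' D j))).re) :
    ∀ᶠ τ in 𝓝 τ₀, (Y ∩ ⋂ j, (fun x ↦ x + τ j) ⁻¹' D j = ∅ ∨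
        HasPureDim 𝓘(ℂ, E) (Y ∩ ⋂ j, (fun x ↦ x + τ j) ⁻¹' D j) r) →
      a < (poincarePairing Φ e (by omega : 2 * r + 2 * p' = n)
        (Complex.ofRealCLM.compContinuousAlternatingMap (kaehlerPow r))
        (setCycleClass Φ e (by omega : 2 * r + 2 * p' = n) (Y ∩ ⋂ j, (fun x ↦ x + τ j) ⁻¹' D j))).re := by
  classical
  have hng : finrank ℂ E * 2 = n := finrank_complex_mul_two Φ e
  have hq1 : q + 1 = finrank ℂ E := by omega
  have h2 : 2 * r + 2 * p' = n := by omega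
  have hrk : r + k * finrank ℂ E = d + ∑ _j : Fin k, q := by
    rw [Finset.sum_const, Finset.card_univ, Fintype.card_fin, smul_eq_mul]
    have : k * finrank ℂ E = k * q + k := by rw [← hq1]; ring
    omega
  -- restate with the fixed proof `h2` of the degree bookkeeping
  have ha' : a < (poincarePairing Φ e h2 (Complex.ofRealCLM.compContinuousAlternatingMap (kaehlerPow r))
      (setCycleClass Φ e h2 (Y ∩ ⋂ j, (fun x ↦ x + τ₀ j) ⁻¹' D j))).re := ha
  suffices hsuff : ∀ᶠ τ in 𝓝 τ₀, (Y ∩ ⋂ j, (fun x ↦ x + τ j) ⁻¹' D j = ∅ ∨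
      HasPureDim 𝓘(ℂ, E) (Y ∩ ⋂ j, (fun x ↦ x + τ j) ⁻¹' D j) r) →
    a < (poincarePairing Φ e h2 (Complex.ofRealCLM.compContinuousAlternatingMap (kaehlerPow r))
      (setCycleClass Φ e h2 (Y ∩ ⋂ j, (fun x ↦ x + τ j) ⁻¹' D j))).re by
    filter_upwards [hsuff] with τ hτ hP
    exact hτ hP
  rcases hZ with hZ0 | hZr
  · -- `Z(τ⁰) = ∅`: `a < 0 ≤ deg Z(τ)`
    rw [re_poincarePairing_kaehlerPow_setCycleClass_of_eq_empty Φ e h2 hZ0] at ha'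
    exact Eventually.of_forall fun τ hτ ↦
      ha'.trans_le (re_poincarePairing_kaehlerPow_setCycleClass_nonneg_of_proper Φ e h2 hτ)
  · -- `Z(τ⁰)` of pure dimension `r`; near `τ⁰` the members are non-empty
    have hne := eventually_inter_iInter_translate_nonempty_of_hasPureDim Φ hY hD hrk hZr
    cases r with
    | zero =>
      -- dimension `0`: degrees are point counts
      have hfin : (Y ∩ ⋂ j, (fun x ↦ x + τ₀ j) ⁻¹' D j).Finite := finite_of_hasPureDim_zero Φ hZr
      have hc0 := re_poincarePairing_kaehlerPow_analyticCycleClass_singleton_nonneg Φ e h2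
      filter_upwards [hne, eventually_ncard_le_ncard_inter_iInter_translate Φ hY hD hrk hfin] with τ hτne hτle hτ
      have hτ0 : HasPureDim 𝓘(ℂ, E) (Y ∩ ⋂ j, (fun x ↦ x + τ j) ⁻¹' D j) 0 := hτ.resolve_left hτne.ne_empty
      have hle := hτle (finite_of_hasPureDim_zero Φ hτ0)
      rw [re_poincarePairing_kaehlerPow_setCycleClass_of_hasPureDim_zero Φ e h2 hZr] at ha'
      rw [re_poincarePairing_kaehlerPow_setCycleClass_of_hasPureDim_zero Φ e h2 hτ0]
      exact ha'.trans_le (mul_le_mul_of_nonneg_right (by exact_mod_cast hle) hc0)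
    | succ r =>
      by_contra hcon
      -- a sequence `τ_m → τ⁰` of proper non-empty members of degree `≤ a`
      have hfreq : ∃ᶠ τ in 𝓝 τ₀, HasPureDim 𝓘(ℂ, E) (Y ∩ ⋂ j, (fun x ↦ x + τ j) ⁻¹' D j) (r + 1) ∧
          (poincarePairing Φ e h2 (Complex.ofRealCLM.compContinuousAlternatingMap (kaehlerPow (r + 1)))
            (setCycleClass Φ e h2 (Y ∩ ⋂ j, (fun x ↦ x + τ j) ⁻¹' D j))).re ≤ a := by
        rw [not_eventually] at hcon
        refine (hcon.and_eventually hne).mono fun τ hτ ↦ ?_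
        obtain ⟨hτ, hτne⟩ := hτ
        obtain ⟨hτP, hτa⟩ := Classical.not_imp.1 hτ
        exact ⟨hτP.resolve_left hτne.ne_empty, not_lt.1 hτa⟩
      obtain ⟨s, hs, hsP⟩ := exists_seq_forall_of_frequently hfreq
      -- the reduced cycles `[Z(τ_m)]`
      set T : ℕ → HolomorphicChain 𝓘(ℂ, E) (ComplexTorus Φ) (r + 1) :=
        fun m ↦ HolomorphicChain.ofSet _ (hsP m).1 with hTdef
      have hT0 : ∀ m W, 0 ≤ (T m).mult W := fun m W ↦ by
        change 0 ≤ (HolomorphicChain.ofSet _ (hsP m).1).mult W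
        rw [HolomorphicChain.mult_ofSet]
        split_ifs
        · exact zero_le_one
        · exact le_rfl
      have hTsupp : ∀ m, (T m).support = Y ∩ ⋂ j, (fun x ↦ x + s m j) ⁻¹' D j := fun m ↦
        HolomorphicChain.support_ofSet (hsP m).1
      have hTcl : ∀ m, chainCycleClass Φ e h2 (T m) = setCycleClass Φ e h2 (Y ∩ ⋂ j, (fun x ↦ x + s m j) ⁻¹' D j) :=
        fun m ↦ by
          change chainCycleClass Φ e h2 (HolomorphicChain.ofSet _ (hsP m).1) = _
          rw [chainCycleClass_ofSet]
          exact (setCycleClass_of_hasPureDim Φ e h2 (hsP m).1).symm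
      have hdeg : ∀ m, (poincarePairing Φ e h2 (Complex.ofRealCLM.compContinuousAlternatingMap (kaehlerPow (r + 1)))
          (chainCycleClass Φ e h2 (T m))).re ≤ a := fun m ↦ by
        rw [hTcl m]
        exact (hsP m).2
      obtain ⟨κ, S, hκ, hS0, -, -, hlim, -, -, hScl⟩ := exists_subseq_effectiveCycle_of_degree_le Φ e h2 hT0 hdeg
      -- `|S| = Z(τ⁰)`
      have hSsupp : S.support = Y ∩ ⋂ j, (fun x ↦ x + τ₀ j) ⁻¹' D j := by
        ext z
        rw [hlim z]
        simp_rw [hTsupp]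
        exact forall_mem_closure_iUnion_iff_of_hasPureDim Φ hY hD hrk hZr (hs.comp hκ.tendsto_atTop) z
      -- `S = [Z(τ⁰)] + T'`, `T' ≥ 0`, so `deg S ≥ deg Z(τ⁰) > a`
      obtain ⟨T', hT'0, -, hST'⟩ := exists_effectiveCycle_eq_ofSet_add_of_support_eq Φ hZr hS0 hSsupp
      have hdegS : (poincarePairing Φ e h2 (Complex.ofRealCLM.compContinuousAlternatingMap (kaehlerPow (r + 1)))
            (setCycleClass Φ e h2 (Y ∩ ⋂ j, (fun x ↦ x + τ₀ j) ⁻¹' D j))).re ≤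
          (poincarePairing Φ e h2 (Complex.ofRealCLM.compContinuousAlternatingMap (kaehlerPow (r + 1)))
            (chainCycleClass Φ e h2 S)).re := by
        rw [hST', chainCycleClass_add, chainCycleClass_ofSet, setCycleClass_of_hasPureDim Φ e h2 hZr, map_add,
          Complex.add_re]
        refine le_add_of_nonneg_right ?_
        by_cases hT' : T' = 0
        · rw [hT', chainCycleClass_zero, map_zero, Complex.zero_re]
        · exact (re_poincarePairing_kaehlerPow_chainCycleClass_pos Φ e _ T' hT'0 hT').le
      obtain ⟨m, hm⟩ := hScl.exists
      have hdm := hdeg (κ m)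
      rw [hm] at hdm
      linarith

/-! ### §2 Multiplicity one is an open condition -/

/-- **MULTIPLICITY ONE IS OPEN.** Let `X` be a compact complex torus, `Y ⊆ X` closed analytic of pure dimension
`d = r + k`, `D₀, …, D_{k−1}` closed analytic hypersurfaces. The set of `τ ∈ X^k` such that
`Z(τ) = Y ∩ ⋂_j (D_j − τ_j)` is PROPER and the intersection class IS the class of the intersection,

  `sign(e)^k · [Y]_e ∧ [D₀]_e ∧ ⋯ ∧ [D_{k−1}]_e = [Z(τ)]_e`

(all components of `Z(τ)` of multiplicity one), is OPEN. Indeed properness is open; if `τ⁰` is in the set and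
`τ → τ⁰` is proper, the excess `T_τ ≥ 0` of file 8 (`c = [Z(τ)] + cl(T_τ)`) has degree
`deg c − deg Z(τ) = deg Z(τ⁰) − deg Z(τ) < v` by lower semicontinuity (§1), `v > 0` the uniform lower bound for
the degree of a non-zero effective `r`-cycle (`exists_pos_le_volume`); so `T_τ = 0`.
[cite: Fulton1998, §10.2 Cor. 10.2.1 and Example 10.2.1; §11.1 Cor. 11.1; Appendix B.9.2]
[cite: Kleiman1974Transversality, Thm. 2] [cite: Chirka1989, §12.1 Prop. (p. 139) and §16.1 Prop. 1] -/
theorem isOpen_setOf_proper_and_smul_wedge_wedgeFamily_eq_setCycleClass {q : ℕ} (hq : 2 * q + 2 * 1 = n)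
    (k : ℕ) {d p p' r : ℕ} (hk : 2 * d + 2 * p = n) (hp' : p + k = p') (hr : r + k = d)
    {Y : Set (ComplexTorus Φ)} (hY : HasPureDim 𝓘(ℂ, E) Y d)
    {D : Fin k → Set (ComplexTorus Φ)} (hD : ∀ j, HasPureDim 𝓘(ℂ, E) (D j) q) :
    IsOpen {τ : Fin k → ComplexTorus Φ |
      (Y ∩ ⋂ j, (fun x ↦ x + τ j) ⁻¹' D j = ∅ ∨ HasPureDim 𝓘(ℂ, E) (Y ∩ ⋂ j, (fun x ↦ x + τ j) ⁻¹' D j) r) ∧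
        (orientationSign Φ e : ℂ) ^ k •
            ((analyticCycleClass Φ e hk hY).wedge
                (wedgeFamily k fun j ↦ analyticCycleClass Φ e hq (hD j))).domDomCongr
              (finCongr (by omega : 2 * p + 2 * k = 2 * p')) =
          setCycleClass Φ e (by omega : 2 * r + 2 * p' = n) (Y ∩ ⋂ j, (fun x ↦ x + τ j) ⁻¹' D j)} := by
  classical
  have hng : finrank ℂ E * 2 = n := finrank_complex_mul_two Φ e
  have hq1 : q + 1 = finrank ℂ E := by omega
  have h2 : 2 * r + 2 * p' = n := by omega
  have hrk : r + k * finrank ℂ E = d + ∑ _j : Fin k, q := by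
    rw [Finset.sum_const, Finset.card_univ, Fintype.card_fin, smul_eq_mul]
    have : k * finrank ℂ E = k * q + k := by rw [← hq1]; ring
    omega
  obtain ⟨v, hv0, hv⟩ := exists_pos_le_volume Φ r
  set c := (orientationSign Φ e : ℂ) ^ k •
      ((analyticCycleClass Φ e hk hY).wedge
          (wedgeFamily k fun j ↦ analyticCycleClass Φ e hq (hD j))).domDomCongr
        (finCongr (by omega : 2 * p + 2 * k = 2 * p')) with hc
  rw [isOpen_iff_mem_nhds]
  rintro τ₀ ⟨hP₀, hcl₀⟩
  have hcl₀' : c = setCycleClass Φ e h2 (Y ∩ ⋂ j, (fun x ↦ x + τ₀ j) ⁻¹' D j) := hcl₀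
  -- (i) properness persists
  have h1 : ∀ᶠ τ in 𝓝 τ₀, Y ∩ ⋂ j, (fun x ↦ x + τ j) ⁻¹' D j = ∅ ∨
      HasPureDim 𝓘(ℂ, E) (Y ∩ ⋂ j, (fun x ↦ x + τ j) ⁻¹' D j) r :=
    (isOpen_setOf_inter_iInter_translate_eq_empty_or_hasPureDim Φ hY hD hrk).mem_nhds hP₀
  -- (ii) lower semicontinuity of the degree at `τ⁰`, with margin `v`
  have hNdef : (poincarePairing Φ e h2 (Complex.ofRealCLM.compContinuousAlternatingMap (kaehlerPow r)) c).re =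
      (poincarePairing Φ e h2 (Complex.ofRealCLM.compContinuousAlternatingMap (kaehlerPow r))
        (setCycleClass Φ e h2 (Y ∩ ⋂ j, (fun x ↦ x + τ₀ j) ⁻¹' D j))).re := by rw [hcl₀']
  have hlsc := eventually_lt_re_poincarePairing_kaehlerPow_setCycleClass_of_proper Φ e hq k hk hp' hr hY hD τ₀ hP₀
    (a := (poincarePairing Φ e h2 (Complex.ofRealCLM.compContinuousAlternatingMap (kaehlerPow r)) c).re - v)
    (show (poincarePairing Φ e h2 (Complex.ofRealCLM.compContinuousAlternatingMap (kaehlerPow r)) c).re - v <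
        (poincarePairing Φ e h2 (Complex.ofRealCLM.compContinuousAlternatingMap (kaehlerPow r))
          (setCycleClass Φ e h2 (Y ∩ ⋂ j, (fun x ↦ x + τ₀ j) ⁻¹' D j))).re by
      rw [hNdef]; linarith)
  filter_upwards [h1, hlsc] with τ hτP hτlt
  refine ⟨hτP, ?_⟩
  have hlt := hτlt hτP
  -- (iii) the excess at `τ` has degree `< v`, hence vanishes
  obtain ⟨T, hT0, -, hTcl⟩ :=
    exists_effectiveCycle_smul_wedge_wedgeFamily_eq_setCycleClass_add_of_proper Φ e hq k hk hp' hr hY hD τ hτP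
  have hTcl' : c = setCycleClass Φ e h2 (Y ∩ ⋂ j, (fun x ↦ x + τ j) ⁻¹' D j) + chainCycleClass Φ e h2 T := hTcl
  have hdegT : (poincarePairing Φ e h2 (Complex.ofRealCLM.compContinuousAlternatingMap (kaehlerPow r))
      (chainCycleClass Φ e h2 T)).re < v := by
    have hsum : (poincarePairing Φ e h2 (Complex.ofRealCLM.compContinuousAlternatingMap (kaehlerPow r)) c).re =
        (poincarePairing Φ e h2 (Complex.ofRealCLM.compContinuousAlternatingMap (kaehlerPow r))
          (setCycleClass Φ e h2 (Y ∩ ⋂ j, (fun x ↦ x + τ j) ⁻¹' D j))).re +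
        (poincarePairing Φ e h2 (Complex.ofRealCLM.compContinuousAlternatingMap (kaehlerPow r))
          (chainCycleClass Φ e h2 T)).re := by
      rw [hTcl', map_add, Complex.add_re]
    change (poincarePairing Φ e h2 (Complex.ofRealCLM.compContinuousAlternatingMap (kaehlerPow r)) c).re - v <
      (poincarePairing Φ e h2 (Complex.ofRealCLM.compContinuousAlternatingMap (kaehlerPow r))
        (setCycleClass Φ e h2 (Y ∩ ⋂ j, (fun x ↦ x + τ j) ⁻¹' D j))).re at hlt
    linarith
  have hT : T = 0 := by
    by_contra hT
    exact (lt_irrefl v) ((le_re_poincarePairing_kaehlerPow_chainCycleClass_of_ne_zero Φ e h2 hv hT0 hT).trans_lt hdegT)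
  change c = setCycleClass Φ e h2 (Y ∩ ⋂ j, (fun x ↦ x + τ j) ⁻¹' D j)
  rw [hTcl', hT, chainCycleClass_zero, add_zero]

/-- **If ONE proper `τ⁰` has multiplicity one, all nearby `τ` are proper of multiplicity one.**
[cite: Fulton1998, §10.2 Example 10.2.1 and §11.1 Cor. 11.1] [cite: Kleiman1974Transversality, Thm. 2] -/
theorem eventually_proper_and_smul_wedge_wedgeFamily_eq_setCycleClass {q : ℕ} (hq : 2 * q + 2 * 1 = n)
    (k : ℕ) {d p p' r : ℕ} (hk : 2 * d + 2 * p = n) (hp' : p + k = p') (hr : r + k = d)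
    {Y : Set (ComplexTorus Φ)} (hY : HasPureDim 𝓘(ℂ, E) Y d)
    {D : Fin k → Set (ComplexTorus Φ)} (hD : ∀ j, HasPureDim 𝓘(ℂ, E) (D j) q) (τ₀ : Fin k → ComplexTorus Φ)
    (hZ : Y ∩ ⋂ j, (fun x ↦ x + τ₀ j) ⁻¹' D j = ∅ ∨
      HasPureDim 𝓘(ℂ, E) (Y ∩ ⋂ j, (fun x ↦ x + τ₀ j) ⁻¹' D j) r)
    (hcl : (orientationSign Φ e : ℂ) ^ k •
        ((analyticCycleClass Φ e hk hY).wedge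
            (wedgeFamily k fun j ↦ analyticCycleClass Φ e hq (hD j))).domDomCongr
          (finCongr (by omega : 2 * p + 2 * k = 2 * p')) =
      setCycleClass Φ e (by omega : 2 * r + 2 * p' = n) (Y ∩ ⋂ j, (fun x ↦ x + τ₀ j) ⁻¹' D j)) :
    ∀ᶠ τ in 𝓝 τ₀,
      (Y ∩ ⋂ j, (fun x ↦ x + τ j) ⁻¹' D j = ∅ ∨ HasPureDim 𝓘(ℂ, E) (Y ∩ ⋂ j, (fun x ↦ x + τ j) ⁻¹' D j) r) ∧
        (orientationSign Φ e : ℂ) ^ k •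
            ((analyticCycleClass Φ e hk hY).wedge
                (wedgeFamily k fun j ↦ analyticCycleClass Φ e hq (hD j))).domDomCongr
              (finCongr (by omega : 2 * p + 2 * k = 2 * p')) =
          setCycleClass Φ e (by omega : 2 * r + 2 * p' = n) (Y ∩ ⋂ j, (fun x ↦ x + τ j) ⁻¹' D j) :=
  (isOpen_setOf_proper_and_smul_wedge_wedgeFamily_eq_setCycleClass Φ e hq k hk hp' hr hY hD).mem_nhds ⟨hZ, hcl⟩

/-! ### §3 Under the positivity hypothesis (P) / on an abelian variety: open, dense, of full measure -/

/-- **Under (P), the multiplicity-one locus is open, dense and of full Haar measure.** With the hypothesis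
of file 5 — an auxiliary hypersurface `H` all of whose `r`-fold translates meet every irreducible
`r`-dimensional closed analytic `W ⊆ Y` — almost every `τ` is proper of multiplicity one
(`ae_smul_wedge_wedgeFamily_eq_setCycleClass`); by §2 the locus is open, hence also dense.
[cite: Lange2023AbelianVarietiesComplex, §4.6.2 Lemma 4.6.4 and p. 235] [cite: Fulton1998, Example 11.4.5, §10.2 Example 10.2.1 and Appendix B.9.2]
[cite: Kleiman1974Transversality, Thm. 2] -/
theorem isOpen_dense_ae_proper_and_smul_wedge_wedgeFamily_eq_setCycleClass {q : ℕ} (hq : 2 * q + 2 * 1 = n)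
    (k : ℕ) {d p p' r : ℕ} (hk : 2 * d + 2 * p = n) (hp' : p + k = p') (hr : r + k = d)
    {Y : Set (ComplexTorus Φ)} (hY : HasPureDim 𝓘(ℂ, E) Y d)
    {D : Fin k → Set (ComplexTorus Φ)} (hD : ∀ j, HasPureDim 𝓘(ℂ, E) (D j) q)
    {H : Set (ComplexTorus Φ)} (hH : HasPureDim 𝓘(ℂ, E) H q)
    (hpos : ∀ W ⊆ Y, IsIrreducibleAnalyticSet 𝓘(ℂ, E) W → HasPureDim 𝓘(ℂ, E) W r →
      ∀ s : Fin r → ComplexTorus Φ, (W ∩ ⋂ i, (fun x ↦ x + s i) ⁻¹' H).Nonempty) :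
    IsOpen {τ : Fin k → ComplexTorus Φ |
      (Y ∩ ⋂ j, (fun x ↦ x + τ j) ⁻¹' D j = ∅ ∨ HasPureDim 𝓘(ℂ, E) (Y ∩ ⋂ j, (fun x ↦ x + τ j) ⁻¹' D j) r) ∧
        (orientationSign Φ e : ℂ) ^ k •
            ((analyticCycleClass Φ e hk hY).wedge
                (wedgeFamily k fun j ↦ analyticCycleClass Φ e hq (hD j))).domDomCongr
              (finCongr (by omega : 2 * p + 2 * k = 2 * p')) =
          setCycleClass Φ e (by omega : 2 * r + 2 * p' = n) (Y ∩ ⋂ j, (fun x ↦ x + τ j) ⁻¹' D j)} ∧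
    Dense {τ : Fin k → ComplexTorus Φ |
      (Y ∩ ⋂ j, (fun x ↦ x + τ j) ⁻¹' D j = ∅ ∨ HasPureDim 𝓘(ℂ, E) (Y ∩ ⋂ j, (fun x ↦ x + τ j) ⁻¹' D j) r) ∧
        (orientationSign Φ e : ℂ) ^ k •
            ((analyticCycleClass Φ e hk hY).wedge
                (wedgeFamily k fun j ↦ analyticCycleClass Φ e hq (hD j))).domDomCongr
              (finCongr (by omega : 2 * p + 2 * k = 2 * p')) =
          setCycleClass Φ e (by omega : 2 * r + 2 * p' = n) (Y ∩ ⋂ j, (fun x ↦ x + τ j) ⁻¹' D j)} ∧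
    ∀ᵐ τ ∂(volume : Measure (Fin k → ComplexTorus Φ)),
      (Y ∩ ⋂ j, (fun x ↦ x + τ j) ⁻¹' D j = ∅ ∨ HasPureDim 𝓘(ℂ, E) (Y ∩ ⋂ j, (fun x ↦ x + τ j) ⁻¹' D j) r) ∧
        (orientationSign Φ e : ℂ) ^ k •
            ((analyticCycleClass Φ e hk hY).wedge
                (wedgeFamily k fun j ↦ analyticCycleClass Φ e hq (hD j))).domDomCongr
              (finCongr (by omega : 2 * p + 2 * k = 2 * p')) =
          setCycleClass Φ e (by omega : 2 * r + 2 * p' = n) (Y ∩ ⋂ j, (fun x ↦ x + τ j) ⁻¹' D j) := by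
  have hae := ae_smul_wedge_wedgeFamily_eq_setCycleClass Φ e hq k hk hp' hr hY hD hH hpos
  exact ⟨isOpen_setOf_proper_and_smul_wedge_wedgeFamily_eq_setCycleClass Φ e hq k hk hp' hr hY hD,
    Measure.dense_of_ae hae, hae⟩

/-- **ON AN ABELIAN VARIETY THE MULTIPLICITY-ONE LOCUS OF ITERATED TRANSLATES IS OPEN, DENSE AND OF FULL
MEASURE.** Let `X` be an abelian variety (a complex torus admitting a Riemann form), `Y ⊆ X` closed analytic
of pure dimension `r + k`, `D₀, …, D_{k−1}` closed analytic hypersurfaces. Then the set of `τ ∈ X^k` with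
`Y ∩ ⋂_j (D_j − τ_j)` proper and `sign(e)^k · [Y]_e ∧ [D₀]_e ∧ ⋯ ∧ [D_{k−1}]_e = [Y ∩ ⋂_j (D_j − τ_j)]_e` is open
and dense and contains almost every `τ`: general translates are transversal in the sense of cycles, and
transversality is STABLE. [cite: Kleiman1974Transversality, Thm. 2] [cite: Fulton1998, §10.2 Example 10.2.1, Example 11.4.5 and Appendix B.9.2]
[cite: Lange2023AbelianVarietiesComplex, §4.6.2 Lemma 4.6.4 and p. 235] -/
theorem IsAbelianVariety.isOpen_dense_ae_proper_and_smul_wedge_wedgeFamily_eq_setCycleClass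
    (hX : IsAbelianVariety Φ) {q : ℕ} (hq : 2 * q + 2 * 1 = n)
    (k : ℕ) {d p p' r : ℕ} (hk : 2 * d + 2 * p = n) (hp' : p + k = p') (hr : r + k = d)
    {Y : Set (ComplexTorus Φ)} (hY : HasPureDim 𝓘(ℂ, E) Y d)
    {D : Fin k → Set (ComplexTorus Φ)} (hD : ∀ j, HasPureDim 𝓘(ℂ, E) (D j) q) :
    IsOpen {τ : Fin k → ComplexTorus Φ |
      (Y ∩ ⋂ j, (fun x ↦ x + τ j) ⁻¹' D j = ∅ ∨ HasPureDim 𝓘(ℂ, E) (Y ∩ ⋂ j, (fun x ↦ x + τ j) ⁻¹' D j) r) ∧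
        (orientationSign Φ e : ℂ) ^ k •
            ((analyticCycleClass Φ e hk hY).wedge
                (wedgeFamily k fun j ↦ analyticCycleClass Φ e hq (hD j))).domDomCongr
              (finCongr (by omega : 2 * p + 2 * k = 2 * p')) =
          setCycleClass Φ e (by omega : 2 * r + 2 * p' = n) (Y ∩ ⋂ j, (fun x ↦ x + τ j) ⁻¹' D j)} ∧
    Dense {τ : Fin k → ComplexTorus Φ |
      (Y ∩ ⋂ j, (fun x ↦ x + τ j) ⁻¹' D j = ∅ ∨ HasPureDim 𝓘(ℂ, E) (Y ∩ ⋂ j, (fun x ↦ x + τ j) ⁻¹' D j) r) ∧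
        (orientationSign Φ e : ℂ) ^ k •
            ((analyticCycleClass Φ e hk hY).wedge
                (wedgeFamily k fun j ↦ analyticCycleClass Φ e hq (hD j))).domDomCongr
              (finCongr (by omega : 2 * p + 2 * k = 2 * p')) =
          setCycleClass Φ e (by omega : 2 * r + 2 * p' = n) (Y ∩ ⋂ j, (fun x ↦ x + τ j) ⁻¹' D j)} ∧
    ∀ᵐ τ ∂(volume : Measure (Fin k → ComplexTorus Φ)),
      (Y ∩ ⋂ j, (fun x ↦ x + τ j) ⁻¹' D j = ∅ ∨ HasPureDim 𝓘(ℂ, E) (Y ∩ ⋂ j, (fun x ↦ x + τ j) ⁻¹' D j) r) ∧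
        (orientationSign Φ e : ℂ) ^ k •
            ((analyticCycleClass Φ e hk hY).wedge
                (wedgeFamily k fun j ↦ analyticCycleClass Φ e hq (hD j))).domDomCongr
              (finCongr (by omega : 2 * p + 2 * k = 2 * p')) =
          setCycleClass Φ e (by omega : 2 * r + 2 * p' = n) (Y ∩ ⋂ j, (fun x ↦ x + τ j) ⁻¹' D j) := by
  have hae := hX.ae_smul_wedge_wedgeFamily_eq_setCycleClass Φ e hq k hk hp' hr hY hD
  exact ⟨isOpen_setOf_proper_and_smul_wedge_wedgeFamily_eq_setCycleClass Φ e hq k hk hp' hr hY hD,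
    Measure.dense_of_ae hae, hae⟩

end ComplexTorus

end Literature.Geometry.Kaehler

end
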